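import Literature.NumberTheory.Sieve.FriedlanderIwaniecPrimesJacobiTwistedProp111
import HarnessLib

/-!
# Friedlander–Iwaniec, *The polynomial `X² + Y⁴` captures its primes*, §14: Proposition 14.1 from Propositions 11.1, 12.1, 13.1

[FI, §14 "Jacobi-twisted sums: Conclusion", p. 53 of arXiv:math/9811185]:

> "We combine the results of Sections 11, 12, 13 to formulate a bound for `V(D)` which is
> nontrivial throughout the range `(log 2RS)^A < D < RS(log 2RS)^{-A}` …
> PROPOSITION 14.1. Let `D, R, S ≥ 1`. For any complex numbers `α_{rs}` with `(r, 2s) = 1`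
> supported in the box `R < r ≤ 2R`, `S < s ≤ 2S`, we have
> `Σ_{D<d≤2D} Σ_{a (mod d)} |Σ_{r̄s ≡ a (mod d)} α_{rs} (r/d)|² ≤ 𝒩(D, R, S) Σ_r Σ_s τ(r)|α_{rs}|²`
> where `𝒩(D, R, S) ≪ D + D^{-1/2}RS + D^{1/3}(RS)^{2/3}(log 2RS)⁴ + (R+S)^{1/12}(RS)^{11/12+ε}` …
> *Proof.* This follows by application of Proposition 11.1 if `D ≤ D₁`, Proposition 13.1 if
> `D₁ < D < D₂`, and Proposition 12.1 if `D ≥ D₂`, where `D₁ = (R+S)^{1/12}(RS)^{3/12}` and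
> `D₂ = (R+S)^{-1/8}(RS)^{3/8}`."

This file PROVES that deduction, with Proposition 11.1 taken from the tree (`exists_jtV_le`) and
Propositions 12.1 ((12.3)–(12.4)) and 13.1 ((13.5)) — not yet in the tree — entering as explicit
hypotheses at the level `D` in question: `jtV_le_of_three_ranges`. The bookkeeping is done with
the thresholds

  `D₁ = (R+S)^{1/12}(RS)^{5/12}`, `D₂ = (R+S)^{-1/6}(RS)^{2/3}`,

which are the ones that make the three printed bounds fit under `𝒩` (with the exponents
`3/12`, `-1/8`, `3/8` of the arXiv rendering the middle range would not close up: at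
`D = (R+S)^{1/12}(RS)^{3/12}` the term `D^{-1/2}(R+S)^{1/8}(RS)^{9/8}` of (13.5) equals
`(R+S)^{1/12} RS`, which exceeds `(R+S)^{1/12}(RS)^{11/12}`; we record this as a rendering/print
slip, the statement of Proposition 14.1 being unaffected). The elementary inequalities behind
the three cases (`R S^{3/4}, S R^{3/4} ≤ (R+S)^{1/12}(RS)^{11/12}`, `R + S ≤ 2RS`, …) are proved
in the section `RealIneq`. No definitions, no named facts.
-/

open Finset Real
open scoped Nat ArithmeticFunction.sigma

namespace Literature.NumberTheory.Sieve.FriedlanderIwaniecPrimes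

/-! ### The exponent bookkeeping -/

section RealIneq

variable {D x y : ℝ}

/-- `x y^{3/4} ≤ (x+y)^{1/12}(xy)^{11/12}` for `x, y ≥ 1`. [folklore] -/
private theorem mul_rpow_three_quarters_le (hx : 1 ≤ x) (hy : 1 ≤ y) :
    x * y ^ (3 / 4 : ℝ) ≤ (x + y) ^ (1 / 12 : ℝ) * (x * y) ^ (11 / 12 : ℝ) := by
  have hx0 : 0 < x := by linarith
  have hy0 : 0 < y := by linarith
  have e1 : x = x ^ (1 / 12 : ℝ) * x ^ (11 / 12 : ℝ) := by
    rw [← Real.rpow_add hx0]; norm_num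
  rw [Real.mul_rpow hx0.le hy0.le]
  calc x * y ^ (3 / 4 : ℝ) = x ^ (1 / 12 : ℝ) * x ^ (11 / 12 : ℝ) * y ^ (3 / 4 : ℝ) := by rw [← e1]
    _ ≤ (x + y) ^ (1 / 12 : ℝ) * x ^ (11 / 12 : ℝ) * y ^ (11 / 12 : ℝ) := by
        refine mul_le_mul (mul_le_mul_of_nonneg_right
          (Real.rpow_le_rpow hx0.le (by linarith) (by norm_num)) (by positivity))
          (Real.rpow_le_rpow_of_exponent_le hy (by norm_num)) (by positivity) (by positivity)
    _ = _ := by ring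

/-- `y x^{3/4} ≤ (x+y)^{1/12}(xy)^{11/12}` for `x, y ≥ 1`. [folklore] -/
private theorem mul_rpow_three_quarters_le' (hx : 1 ≤ x) (hy : 1 ≤ y) :
    y * x ^ (3 / 4 : ℝ) ≤ (x + y) ^ (1 / 12 : ℝ) * (x * y) ^ (11 / 12 : ℝ) := by
  have h := mul_rpow_three_quarters_le hy hx
  rwa [add_comm y x, mul_comm y x] at h

/-- Case `D ≤ D₁ = (x+y)^{1/12}(xy)^{5/12}`: `D √(xy) ≤ (x+y)^{1/12}(xy)^{11/12}`. [folklore] -/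
private theorem mul_sqrt_le_of_le_D₁ (hx : 1 ≤ x) (hy : 1 ≤ y)
    (hD : D ≤ (x + y) ^ (1 / 12 : ℝ) * (x * y) ^ (5 / 12 : ℝ)) :
    D * Real.sqrt (x * y) ≤ (x + y) ^ (1 / 12 : ℝ) * (x * y) ^ (11 / 12 : ℝ) := by
  have hp0 : 0 < x * y := mul_pos (by linarith) (by linarith)
  calc D * Real.sqrt (x * y) ≤ (x + y) ^ (1 / 12 : ℝ) * (x * y) ^ (5 / 12 : ℝ) * Real.sqrt (x * y) :=
        mul_le_mul_of_nonneg_right hD (Real.sqrt_nonneg _)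
    _ = (x + y) ^ (1 / 12 : ℝ) * (x * y) ^ (11 / 12 : ℝ) := by
        rw [Real.sqrt_eq_rpow, mul_assoc, ← Real.rpow_add hp0]; norm_num

/-- Case `D ≤ D₂ = (x+y)^{-1/6}(xy)^{2/3}`: `D (x+y)^{1/4}(xy)^{1/4} ≤ (x+y)^{1/12}(xy)^{11/12}`.
[folklore] -/
private theorem mul_rpow_quarter_le_of_le_D₂ (hx : 1 ≤ x) (hy : 1 ≤ y)
    (hD : D ≤ (x + y) ^ (-(1 / 6 : ℝ)) * (x * y) ^ (2 / 3 : ℝ)) :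
    D * (x + y) ^ (1 / 4 : ℝ) * (x * y) ^ (1 / 4 : ℝ) ≤ (x + y) ^ (1 / 12 : ℝ) * (x * y) ^ (11 / 12 : ℝ) := by
  have hp0 : 0 < x * y := mul_pos (by linarith) (by linarith)
  have hs0 : 0 < x + y := by linarith
  calc D * (x + y) ^ (1 / 4 : ℝ) * (x * y) ^ (1 / 4 : ℝ)
      ≤ (x + y) ^ (-(1 / 6 : ℝ)) * (x * y) ^ (2 / 3 : ℝ) * (x + y) ^ (1 / 4 : ℝ) * (x * y) ^ (1 / 4 : ℝ) := by
        gcongr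
    _ = ((x + y) ^ (-(1 / 6 : ℝ)) * (x + y) ^ (1 / 4 : ℝ)) * ((x * y) ^ (2 / 3 : ℝ) * (x * y) ^ (1 / 4 : ℝ)) := by
        ring
    _ = (x + y) ^ (1 / 12 : ℝ) * (x * y) ^ (11 / 12 : ℝ) := by
        rw [← Real.rpow_add hs0, ← Real.rpow_add hp0]; norm_num

/-- Case `D ≥ D₁`: `D^{-1/2}(x+y)^{1/8}(xy)^{9/8} ≤ (x+y)^{1/12}(xy)^{11/12}`. [folklore] -/
private theorem rpow_neg_half_mul_le_of_D₁_le (hx : 1 ≤ x) (hy : 1 ≤ y)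
    (hD : (x + y) ^ (1 / 12 : ℝ) * (x * y) ^ (5 / 12 : ℝ) ≤ D) :
    D ^ (-(1 / 2 : ℝ)) * (x + y) ^ (1 / 8 : ℝ) * (x * y) ^ (9 / 8 : ℝ) ≤
      (x + y) ^ (1 / 12 : ℝ) * (x * y) ^ (11 / 12 : ℝ) := by
  have hp0 : 0 < x * y := mul_pos (by linarith) (by linarith)
  have hs0 : 0 < x + y := by linarith
  have hD1 : 0 < (x + y) ^ (1 / 12 : ℝ) * (x * y) ^ (5 / 12 : ℝ) := by positivity
  have hD0 : 0 < D := lt_of_lt_of_le hD1 hD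
  -- `D^{-1/2} ≤ D₁^{-1/2} = (x+y)^{-1/24}(xy)^{-5/24}`
  have h1 : D ^ (-(1 / 2 : ℝ)) ≤ (x + y) ^ (-(1 / 24 : ℝ)) * (x * y) ^ (-(5 / 24 : ℝ)) := by
    calc D ^ (-(1 / 2 : ℝ)) ≤ ((x + y) ^ (1 / 12 : ℝ) * (x * y) ^ (5 / 12 : ℝ)) ^ (-(1 / 2 : ℝ)) :=
          Real.rpow_le_rpow_of_nonpos hD1 hD (by norm_num)
      _ = (x + y) ^ (-(1 / 24 : ℝ)) * (x * y) ^ (-(5 / 24 : ℝ)) := by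
          rw [Real.mul_rpow (by positivity) (by positivity), ← Real.rpow_mul hs0.le,
            ← Real.rpow_mul hp0.le]
          norm_num
  calc D ^ (-(1 / 2 : ℝ)) * (x + y) ^ (1 / 8 : ℝ) * (x * y) ^ (9 / 8 : ℝ)
      ≤ (x + y) ^ (-(1 / 24 : ℝ)) * (x * y) ^ (-(5 / 24 : ℝ)) * (x + y) ^ (1 / 8 : ℝ) * (x * y) ^ (9 / 8 : ℝ) := by
        gcongr
    _ = ((x + y) ^ (-(1 / 24 : ℝ)) * (x + y) ^ (1 / 8 : ℝ)) * ((x * y) ^ (-(5 / 24 : ℝ)) * (x * y) ^ (9 / 8 : ℝ)) := by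
        ring
    _ = (x + y) ^ (1 / 12 : ℝ) * (x * y) ^ (11 / 12 : ℝ) := by
        rw [← Real.rpow_add hs0, ← Real.rpow_add hp0]; norm_num

/-- Case `D ≥ D₂`: `D⁻¹(xy)^{3/2} ≤ 2(x+y)^{1/12}(xy)^{11/12}` (using `x + y ≤ 2xy`). [folklore] -/
private theorem inv_mul_rpow_le_of_D₂_le (hx : 1 ≤ x) (hy : 1 ≤ y)
    (hD : (x + y) ^ (-(1 / 6 : ℝ)) * (x * y) ^ (2 / 3 : ℝ) ≤ D) :
    D⁻¹ * (x * y) ^ (3 / 2 : ℝ) ≤ 2 * ((x + y) ^ (1 / 12 : ℝ) * (x * y) ^ (11 / 12 : ℝ)) := by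
  have hx0 : 0 < x := by linarith
  have hy0 : 0 < y := by linarith
  have hp0 : 0 < x * y := mul_pos hx0 hy0
  have hs0 : 0 < x + y := by linarith
  have hsp : x + y ≤ 2 * (x * y) := by nlinarith
  have hD2 : 0 < (x + y) ^ (-(1 / 6 : ℝ)) * (x * y) ^ (2 / 3 : ℝ) := by positivity
  have h1 : D⁻¹ ≤ (x + y) ^ (1 / 6 : ℝ) * (x * y) ^ (-(2 / 3 : ℝ)) := by
    have := inv_anti₀ hD2 hD
    rwa [mul_inv, ← Real.rpow_neg hs0.le, ← Real.rpow_neg hp0.le, neg_neg] at this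
  calc D⁻¹ * (x * y) ^ (3 / 2 : ℝ) ≤ (x + y) ^ (1 / 6 : ℝ) * (x * y) ^ (-(2 / 3 : ℝ)) * (x * y) ^ (3 / 2 : ℝ) :=
        mul_le_mul_of_nonneg_right h1 (by positivity)
    _ = (x + y) ^ (1 / 12 : ℝ) * (x + y) ^ (1 / 12 : ℝ) * (x * y) ^ (10 / 12 : ℝ) := by
        rw [mul_assoc, ← Real.rpow_add hp0, ← Real.rpow_add hs0]; norm_num
    _ ≤ (x + y) ^ (1 / 12 : ℝ) * (2 * (x * y)) ^ (1 / 12 : ℝ) * (x * y) ^ (10 / 12 : ℝ) := by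
        gcongr
    _ = 2 ^ (1 / 12 : ℝ) * ((x + y) ^ (1 / 12 : ℝ) * (x * y) ^ (11 / 12 : ℝ)) := by
        rw [Real.mul_rpow (by norm_num) hp0.le]
        have : (x * y) ^ (11 / 12 : ℝ) = (x * y) ^ (1 / 12 : ℝ) * (x * y) ^ (10 / 12 : ℝ) := by
          rw [← Real.rpow_add hp0]; norm_num
        rw [this]; ring
    _ ≤ 2 * ((x + y) ^ (1 / 12 : ℝ) * (x * y) ^ (11 / 12 : ℝ)) := by
        gcongr
        calc (2 : ℝ) ^ (1 / 12 : ℝ) ≤ (2 : ℝ) ^ (1 : ℝ) :=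
              Real.rpow_le_rpow_of_exponent_le (by norm_num) (by norm_num)
          _ = 2 := Real.rpow_one 2

/-- `xy/√D = D^{-1/2} xy` (`D > 0`). [folklore] -/
private theorem div_sqrt_eq_rpow_neg_half_mul (hD : 0 < D) (x y : ℝ) :
    x * y / Real.sqrt D = D ^ (-(1 / 2 : ℝ)) * (x * y) := by
  rw [Real.sqrt_eq_rpow, Real.rpow_neg hD.le, div_eq_mul_inv, mul_comm]

end RealIneq

/-! ### Proposition 14.1 -/

/-- `‖α‖² ≤ Σ τ(r)|α_{rs}|²` (`τ(r) ≥ 1`). [folklore] -/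
private theorem normSq_le_tau_normSq (R S : ℕ) (α : ℕ → ℕ → ℂ) :
    ∑ r ∈ Ioc R (2 * R), ∑ s ∈ Ioc S (2 * S), ‖α r s‖ ^ 2 ≤
      ∑ r ∈ Ioc R (2 * R), ∑ s ∈ Ioc S (2 * S), (σ 0 r : ℝ) * ‖α r s‖ ^ 2 := by
  refine Finset.sum_le_sum fun r hr => Finset.sum_le_sum fun s _ => ?_
  have hr0 : r ≠ 0 := by have := (Finset.mem_Ioc.mp hr).1; omega
  have h1 : (1 : ℝ) ≤ (σ 0 r : ℝ) := by
    rw [ArithmeticFunction.sigma_zero_apply]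
    exact_mod_cast Finset.card_pos.mpr ⟨1, Nat.one_mem_divisors.mpr hr0⟩
  nlinarith [norm_nonneg (α r s), sq_nonneg ‖α r s‖]

set_option maxHeartbeats 400000 in
/-- **Proposition 14.1 from Propositions 11.1, 12.1 and 13.1.** For every `ε > 0` there is
`C₁₁ > 0` (the constant of Proposition 11.1, from the tree) such that for all `D, R, S ≥ 1`, all
coefficients `α_{rs}`, and all `C₁₂, C₁₃ ≥ 0` for which the bounds (12.3)–(12.4) of Proposition 12.1
and (13.5) of Proposition 13.1 hold at level `D`,
`V(D) ≤ 4(C₁₁ + C₁₂ + C₁₃){D + D^{-1/2}RS + D^{1/3}(RS)^{2/3}(log 2RS)⁴ + (R+S)^{1/12}(RS)^{11/12}(RS)^ε} Σ τ(r)|α_{rs}|²`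
(Proposition 11.1 for `D ≤ D₁ = (R+S)^{1/12}(RS)^{5/12}`, Proposition 13.1 for `D₁ < D < D₂`,
Proposition 12.1 for `D ≥ D₂ = (R+S)^{-1/6}(RS)^{2/3}`).
[cite: FriedlanderIwaniecAnnals1998, Proposition 14.1] -/
theorem jtV_le_of_three_ranges {ε : ℝ} (hε : 0 < ε) :
    ∃ C₁₁ : ℝ, 0 < C₁₁ ∧ ∀ (D R S : ℕ) (α : ℕ → ℕ → ℂ) (C₁₂ C₁₃ : ℝ), 1 ≤ D → 1 ≤ R → 1 ≤ S →
      0 ≤ C₁₂ → 0 ≤ C₁₃ →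
      jtV D (2 * D) R S α ≤ C₁₂ * ((D : ℝ) + (D : ℝ) ^ (1 / 3 : ℝ) * ((R : ℝ) * S) ^ (2 / 3 : ℝ) *
            Real.log (2 * R * S) ^ 4 +
          ((D : ℝ)⁻¹ * ((R : ℝ) * S) ^ (3 / 2 : ℝ) + R * (S : ℝ) ^ (3 / 4 : ℝ) + S * (R : ℝ) ^ (3 / 4 : ℝ)) *
            ((R : ℝ) * S) ^ ε) *
        ∑ r ∈ Ioc R (2 * R), ∑ s ∈ Ioc S (2 * S), (σ 0 r : ℝ) * ‖α r s‖ ^ 2 →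
      jtV D (2 * D) R S α ≤ C₁₃ * (((D : ℝ) * ((R : ℝ) + S) ^ (1 / 4 : ℝ) * ((R : ℝ) * S) ^ (1 / 4 : ℝ) +
          (D : ℝ) ^ (-(1 / 2 : ℝ)) * ((R : ℝ) + S) ^ (1 / 8 : ℝ) * ((R : ℝ) * S) ^ (9 / 8 : ℝ)) *
            ((R : ℝ) * S) ^ ε) *
        ∑ r ∈ Ioc R (2 * R), ∑ s ∈ Ioc S (2 * S), (σ 0 r : ℝ) * ‖α r s‖ ^ 2 →
      jtV D (2 * D) R S α ≤ 4 * (C₁₁ + C₁₂ + C₁₃) *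
        ((D : ℝ) + (D : ℝ) ^ (-(1 / 2 : ℝ)) * ((R : ℝ) * S) +
          (D : ℝ) ^ (1 / 3 : ℝ) * ((R : ℝ) * S) ^ (2 / 3 : ℝ) * Real.log (2 * R * S) ^ 4 +
          ((R : ℝ) + S) ^ (1 / 12 : ℝ) * ((R : ℝ) * S) ^ (11 / 12 : ℝ) * ((R : ℝ) * S) ^ ε) *
        ∑ r ∈ Ioc R (2 * R), ∑ s ∈ Ioc S (2 * S), (σ 0 r : ℝ) * ‖α r s‖ ^ 2 := by
  obtain ⟨C₁₁, hC₁₁, h11⟩ := exists_jtV_le hε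
  refine ⟨C₁₁, hC₁₁, fun D R S α C₁₂ C₁₃ hD hR hS hC₁₂ hC₁₃ h12 h13 => ?_⟩
  have hV := h11 D R S α hD hR hS
  -- real shorthands
  set x : ℝ := (R : ℝ) with hx
  set y : ℝ := (S : ℝ) with hy
  set d : ℝ := (D : ℝ) with hd
  have hx1 : 1 ≤ x := by rw [hx]; exact_mod_cast hR
  have hy1 : 1 ≤ y := by rw [hy]; exact_mod_cast hS
  have hd1 : 1 ≤ d := by rw [hd]; exact_mod_cast hD
  have hd0 : 0 < d := by linarith
  have hp0 : 0 < x * y := mul_pos (by linarith) (by linarith)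
  set Nτ : ℝ := ∑ r ∈ Ioc R (2 * R), ∑ s ∈ Ioc S (2 * S), (σ 0 r : ℝ) * ‖α r s‖ ^ 2 with hNτ
  have hNτ0 : 0 ≤ Nτ := by rw [hNτ]; positivity
  have hN2 : ∑ r ∈ Ioc R (2 * R), ∑ s ∈ Ioc S (2 * S), ‖α r s‖ ^ 2 ≤ Nτ := normSq_le_tau_normSq R S α
  have hN20 : 0 ≤ ∑ r ∈ Ioc R (2 * R), ∑ s ∈ Ioc S (2 * S), ‖α r s‖ ^ 2 := by positivity
  set Z : ℝ := (x + y) ^ (1 / 12 : ℝ) * (x * y) ^ (11 / 12 : ℝ) with hZ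
  have hZ0 : 0 ≤ Z := by positivity
  set Lg : ℝ := Real.log (2 * x * y) ^ 4 with hLg
  have hLg0 : 0 ≤ Lg := by rw [hLg]; positivity
  have hpe : 0 ≤ (x * y) ^ ε := by positivity
  -- the four summands of `𝒩`
  have hT1 : 0 ≤ d := hd0.le
  have hT2 : 0 ≤ d ^ (-(1 / 2 : ℝ)) * (x * y) := by positivity
  have hT3 : 0 ≤ d ^ (1 / 3 : ℝ) * (x * y) ^ (2 / 3 : ℝ) * Lg := by positivity
  have hT4 : 0 ≤ Z * (x * y) ^ ε := by positivity
  set N14 : ℝ := d + d ^ (-(1 / 2 : ℝ)) * (x * y) + d ^ (1 / 3 : ℝ) * (x * y) ^ (2 / 3 : ℝ) * Lg +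
      Z * (x * y) ^ ε with hN14
  have hN14_0 : 0 ≤ N14 := by rw [hN14]; positivity
  have hA3 := mul_rpow_three_quarters_le hx1 hy1
  have hA4 := mul_rpow_three_quarters_le' hx1 hy1
  have hfin : ∀ {C k : ℝ}, 0 ≤ C → k ≤ 4 → C ≤ C₁₁ + C₁₂ + C₁₃ →
      C * (k * N14) * Nτ ≤ 4 * (C₁₁ + C₁₂ + C₁₃) * N14 * Nτ := by
    intro C k hC hk hCle
    refine mul_le_mul_of_nonneg_right ?_ hNτ0
    have h1 : C * (k * N14) ≤ C * (4 * N14) :=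
      mul_le_mul_of_nonneg_left (mul_le_mul_of_nonneg_right hk hN14_0) hC
    have h2 : C * (4 * N14) ≤ (C₁₁ + C₁₂ + C₁₃) * (4 * N14) :=
      mul_le_mul_of_nonneg_right hCle (by positivity)
    linarith
  -- the three ranges
  by_cases hlow : d ≤ (x + y) ^ (1 / 12 : ℝ) * (x * y) ^ (5 / 12 : ℝ)
  · -- Proposition 11.1
    have hA1 := div_sqrt_eq_rpow_neg_half_mul hd0 x y
    have hA2 := mul_sqrt_le_of_le_D₁ hx1 hy1 hlow
    have h2 : d * Real.sqrt (x * y) + x * y ^ (3 / 4 : ℝ) + y * x ^ (3 / 4 : ℝ) ≤ 3 * Z := by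
      linarith
    have h3 : (d * Real.sqrt (x * y) + x * y ^ (3 / 4 : ℝ) + y * x ^ (3 / 4 : ℝ)) * (x * y) ^ ε ≤
        3 * (Z * (x * y) ^ ε) := by
      have := mul_le_mul_of_nonneg_right h2 hpe
      linarith
    have hbound : x * y / Real.sqrt d + (d * Real.sqrt (x * y) + x * y ^ (3 / 4 : ℝ) +
        y * x ^ (3 / 4 : ℝ)) * (x * y) ^ ε ≤ 3 * N14 := by
      rw [hA1, hN14]
      linarith
    calc jtV D (2 * D) R S α ≤ _ := hV
      _ ≤ C₁₁ * (3 * N14) * Nτ :=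
          mul_le_mul (mul_le_mul_of_nonneg_left hbound hC₁₁.le) hN2 hN20 (by positivity)
      _ ≤ 4 * (C₁₁ + C₁₂ + C₁₃) * N14 * Nτ := hfin hC₁₁.le (by norm_num) (by linarith)
  · by_cases hhigh : (x + y) ^ (-(1 / 6 : ℝ)) * (x * y) ^ (2 / 3 : ℝ) ≤ d
    · -- Proposition 12.1
      have hC1 := inv_mul_rpow_le_of_D₂_le hx1 hy1 hhigh
      have h2 : d⁻¹ * (x * y) ^ (3 / 2 : ℝ) + x * y ^ (3 / 4 : ℝ) + y * x ^ (3 / 4 : ℝ) ≤ 4 * Z := by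
        linarith
      have h3 : (d⁻¹ * (x * y) ^ (3 / 2 : ℝ) + x * y ^ (3 / 4 : ℝ) + y * x ^ (3 / 4 : ℝ)) * (x * y) ^ ε ≤
          4 * (Z * (x * y) ^ ε) := by
        have := mul_le_mul_of_nonneg_right h2 hpe
        linarith
      have hbound : d + d ^ (1 / 3 : ℝ) * (x * y) ^ (2 / 3 : ℝ) * Lg +
          (d⁻¹ * (x * y) ^ (3 / 2 : ℝ) + x * y ^ (3 / 4 : ℝ) + y * x ^ (3 / 4 : ℝ)) * (x * y) ^ ε ≤
          4 * N14 := by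
        rw [hN14]
        linarith
      calc jtV D (2 * D) R S α ≤ _ := h12
        _ ≤ C₁₂ * (4 * N14) * Nτ :=
            mul_le_mul_of_nonneg_right (mul_le_mul_of_nonneg_left hbound hC₁₂) hNτ0
        _ ≤ 4 * (C₁₁ + C₁₂ + C₁₃) * N14 * Nτ := hfin hC₁₂ le_rfl (by linarith)
    · -- Proposition 13.1
      rw [not_le] at hlow hhigh
      have hB1 := mul_rpow_quarter_le_of_le_D₂ hx1 hy1 hhigh.le
      have hB2 := rpow_neg_half_mul_le_of_D₁_le hx1 hy1 hlow.le
      have h2 : d * (x + y) ^ (1 / 4 : ℝ) * (x * y) ^ (1 / 4 : ℝ) +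
          d ^ (-(1 / 2 : ℝ)) * (x + y) ^ (1 / 8 : ℝ) * (x * y) ^ (9 / 8 : ℝ) ≤ 2 * Z := by
        linarith
      have hbound : (d * (x + y) ^ (1 / 4 : ℝ) * (x * y) ^ (1 / 4 : ℝ) +
          d ^ (-(1 / 2 : ℝ)) * (x + y) ^ (1 / 8 : ℝ) * (x * y) ^ (9 / 8 : ℝ)) * (x * y) ^ ε ≤ 2 * N14 := by
        rw [hN14]
        have := mul_le_mul_of_nonneg_right h2 hpe
        linarith
      calc jtV D (2 * D) R S α ≤ _ := h13
        _ ≤ C₁₃ * (2 * N14) * Nτ :=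
            mul_le_mul_of_nonneg_right (mul_le_mul_of_nonneg_left hbound hC₁₃) hNτ0
        _ ≤ 4 * (C₁₁ + C₁₂ + C₁₃) * N14 * Nτ := hfin hC₁₃ (by norm_num) (by linarith)

end Literature.NumberTheory.Sieve.FriedlanderIwaniecPrimes
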